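import Literature.NumberTheory.Automorphic.BrandtModuleResidueBasic
import HarnessLib

/-!
# The standard involution on `O / p O` and the Peirce pieces of a non-trivial idempotent

Fifth layer of the proof files for the named fact `brandtMatrix_comm` of `BrandtModule.lean`
(Vignéras, LNM 800, III §5 ex. 5.8; Eichler 1973, II §6 Thm. 2), continuing the residual
structure theory of `A = O / p O` (`BrandtModuleResidueBasic.lean`):

* `x ↦ x̄` is an anti-automorphism on an order (`IsZOrder.standardInvolution_mul_rev`,
  from `xy + yx = t(x) y + t(y) x − polZ x y`), inducing **`barA : A → A`**
  (`IsZOrder.barA`, through the ring map `O → Aᵐᵒᵖ`): additive, anti-multiplicative,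
  involutive, `barA (res x) = res x̄`, `a · barA a = barA a · a = n(a)` a scalar.
* For a **non-trivial idempotent** `e = res x` of `A`: `p ∣ n(x)`, `t(x) ≡ 1`, **`barA e = 1 − e`**
  (`IsZOrder.barA_eq_one_sub_of_idempotent`; Vignéras: `n(e) ∈ {0,1}`, `e ē = n(e)`, `t(e) = 1`);
  `barA` maps `e A e` bijectively onto `f A f` (`f = 1 − e`) and preserves `e A f`, `f A e`;
  hence **`|eAe| = |fAf|`**, and with `|A| = p⁴`, `p ∣ |eAe|` the **size constraint**
  (`IsZOrder.card_peirceCorner_cases`): either `|eAe| = |fAf| = p`, `|eAf| |fAe| = p²`, or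
  `|eAe| = |fAf| = p²` and `eAf = fAe = 0`.

These are the inputs of the residual classification of `O / p O` for maximal `O`
(`BrandtModuleResidueSplit.lean`, `BrandtModuleResidueRamified.lean`).

## References

* M.-F. Vignéras, *Arithmétique des algèbres de quaternions*, LNM 800 (1980), Ch. I §1
  (Lemme 1.1), Ch. II §§1–2 [VignerasLNM800].
-/

noncomputable section

open scoped Pointwise

universe u

namespace Literature.NumberTheory.Automorphic

namespace IsZOrder

variable {B : Type u} [Ring B] [Algebra ℚ B] [IsQuaternionAlgebra ℚ B] {O : Submodule ℤ B}

/-! ### The standard involution is an anti-automorphism of an order -/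

/-- **`xy + yx = t(x) y + t(y) x − polZ x y`** on an order (three instances of
`z² = t(z) z − n(z)` and the polarisation identity). [cite: VignerasLNM800, Ch. I §1 Lemme 1.1] -/
theorem mul_add_mul_swap (hO : IsZOrder O) {x y : B} (hx : x ∈ O) (hy : y ∈ O) :
    x * y + y * x = (trdZ x : ℤ) • y + (trdZ y : ℤ) • x - (polZ x y : ℤ) • (1 : B) := by
  have h1 := hO.mul_self_eq_trdZ hx
  have h2 := hO.mul_self_eq_trdZ hy
  have h3 := hO.mul_self_eq_trdZ (O.add_mem hx hy)
  rw [hO.trdZ_add hx hy, hO.nrdZ_add hx hy] at h3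
  have : x * y + y * x = (x + y) * (x + y) - x * x - y * y := by noncomm_ring
  rw [this, h1, h2, h3]
  simp only [smul_add, add_smul]
  abel

/-- **`x ↦ x̄` is anti-multiplicative on an order**: `(x y)‾ = ȳ x̄` (Vignéras I §1: the
conjugation is an anti-automorphism). [cite: VignerasLNM800, Ch. I §1 Lemme 1.1] -/
theorem standardInvolution_mul_rev (hO : IsZOrder O) {x y : B} (hx : x ∈ O) (hy : y ∈ O) :
    standardInvolution ℚ B (x * y) = standardInvolution ℚ B y * standardInvolution ℚ B x := by
  rw [hO.standardInvolution_eq (hO.mul_mem _ hx _ hy), hO.standardInvolution_eq hx,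
    hO.standardInvolution_eq hy]
  have hkey := hO.mul_add_mul_swap hx hy
  have htxy : (trdZ (x * y) : ℤ) = trdZ y * trdZ x - polZ x y := by rw [polZ]; ring
  -- expand `(t_y − y)(t_x − x)` and compare with `t_xy − xy` using `hkey`
  have hexp : ((trdZ y : ℤ) • (1 : B) - y) * ((trdZ x : ℤ) • (1 : B) - x) =
      (trdZ y * trdZ x : ℤ) • (1 : B) - (trdZ y : ℤ) • x - (trdZ x : ℤ) • y + y * x := by
    simp only [sub_mul, mul_sub, smul_sub, smul_mul_assoc, mul_smul_comm, one_mul, mul_one, smul_smul,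
      mul_comm (trdZ x) (trdZ y)]
    abel
  have hyx : y * x = (trdZ x : ℤ) • y + (trdZ y : ℤ) • x - (polZ x y : ℤ) • (1 : B) - x * y := by
    rw [← hkey]; abel
  rw [htxy, sub_smul, hexp, hyx]
  abel

/-- `x̄‾ = x` on an order. [cite: VignerasLNM800, Ch. I §1] -/
theorem standardInvolution_standardInvolution (hO : IsZOrder O) {x : B} (hx : x ∈ O) :
    standardInvolution ℚ B (standardInvolution ℚ B x) = x := by
  have hbx := hO.standardInvolution_mem hx
  rw [hO.standardInvolution_eq hbx]
  have ht : trdZ (standardInvolution ℚ B x) = trdZ x := by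
    rw [hO.standardInvolution_eq hx, sub_eq_add_neg, hO.trdZ_add (O.smul_mem _ hO.one_mem) (O.neg_mem hx),
      hO.trdZ_zsmul _ hO.one_mem, trdZ_one, ← neg_one_zsmul, hO.trdZ_zsmul _ hx]
    ring
  rw [ht, hO.standardInvolution_eq hx, sub_sub_cancel]

/-- `1̄ = 1`. [folklore] -/
theorem standardInvolution_one (hO : IsZOrder O) : standardInvolution ℚ B (1 : B) = 1 := by
  rw [hO.standardInvolution_eq hO.one_mem, trdZ_one, two_smul]
  abel

/-! ### The involution `barA` on `A = O / p O` -/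

variable {p : ℕ}

/-- The conjugation as a ring map `O → (O / p O)ᵐᵒᵖ`. [folklore] -/
def barHom (hO : IsZOrder O) (p : ℕ) : hO.subring →+* (hO.Residue p)ᵐᵒᵖ where
  toFun x := MulOpposite.op (hO.res p (hO.barS x))
  map_one' := by
    rw [← MulOpposite.op_one]
    congr 1
    rw [← map_one (hO.res p)]
    congr 1
    exact Subtype.ext (hO.standardInvolution_one)
  map_mul' x y := by
    rw [← MulOpposite.op_mul, ← map_mul]
    congr 2
    exact Subtype.ext (hO.standardInvolution_mul_rev x.2 y.2)
  map_zero' := by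
    rw [← MulOpposite.op_zero]
    congr 1
    rw [hO.barS_eq, map_sub, map_intCast, map_zero, sub_zero]
    have : trdZ ((0 : hO.subring) : B) = 0 := by
      rw [Subring.coe_zero, ← zero_smul ℤ (1 : B), hO.trdZ_zsmul _ hO.one_mem, zero_mul]
    rw [this, Int.cast_zero]
  map_add' x y := by
    rw [← MulOpposite.op_add, ← map_add]
    congr 2
    apply Subtype.ext
    change standardInvolution ℚ B (x + y : B) = standardInvolution ℚ B x + standardInvolution ℚ B y
    rw [hO.standardInvolution_eq (O.add_mem x.2 y.2), hO.standardInvolution_eq x.2,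
      hO.standardInvolution_eq y.2, hO.trdZ_add x.2 y.2, add_smul]
    abel

/-- `barHom` kills `p O`. [folklore] -/
theorem barHom_modIdeal (hO : IsZOrder O) (p : ℕ) : ∀ a ∈ hO.modIdeal p, hO.barHom p a = 0 := by
  intro a ha
  obtain ⟨y, rfl⟩ := mem_modIdeal_iff.mp ha
  have hp0 : ((p : ℕ) : (hO.Residue p)ᵐᵒᵖ) = 0 := by
    rw [← MulOpposite.op_natCast, natCast_self_residue, MulOpposite.op_zero]
  rw [map_mul, map_natCast, hp0, zero_mul]

/-- **The standard involution on `A = O / p O`**: `barA (res x) = res x̄`; additive,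
anti-multiplicative, involutive. [cite: VignerasLNM800, Ch. I §1] -/
def barA (hO : IsZOrder O) (p : ℕ) (a : hO.Residue p) : hO.Residue p :=
  MulOpposite.unop (Ideal.Quotient.lift (hO.modIdeal p) (hO.barHom p) (hO.barHom_modIdeal p) a)

/-- `barA (res x) = res x̄`. [folklore] -/
theorem barA_res (hO : IsZOrder O) (x : hO.subring) : hO.barA p (hO.res p x) = hO.res p (hO.barS x) := by
  rw [barA, res, Ideal.Quotient.lift_mk]
  rfl

/-- `barA (res x) = t(x) − res x`. [folklore] -/
theorem barA_res_eq (hO : IsZOrder O) (x : hO.subring) :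
    hO.barA p (hO.res p x) = (trdZ (x : B) : hO.Residue p) - hO.res p x := by
  rw [barA_res, res_barS]

/-- `barA` is additive. [folklore] -/
theorem barA_add (hO : IsZOrder O) (a b : hO.Residue p) : hO.barA p (a + b) = hO.barA p a + hO.barA p b := by
  simp only [barA, map_add, MulOpposite.unop_add]

/-- `barA` is anti-multiplicative. [cite: VignerasLNM800, Ch. I §1] -/
theorem barA_mul (hO : IsZOrder O) (a b : hO.Residue p) : hO.barA p (a * b) = hO.barA p b * hO.barA p a := by
  simp only [barA, map_mul, MulOpposite.unop_mul]

/-- `barA 1 = 1`. [folklore] -/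
theorem barA_one (hO : IsZOrder O) : hO.barA p 1 = 1 := by
  simp only [barA, map_one, MulOpposite.unop_one]

/-- `barA 0 = 0`. [folklore] -/
theorem barA_zero (hO : IsZOrder O) : hO.barA p 0 = 0 := by
  simp only [barA, map_zero, MulOpposite.unop_zero]

/-- `barA` is `ℤ`-linear: `barA (k : A) = k`, `barA (a − b) = barA a − barA b`. [folklore] -/
theorem barA_sub (hO : IsZOrder O) (a b : hO.Residue p) : hO.barA p (a - b) = hO.barA p a - hO.barA p b := by
  simp only [barA, map_sub, MulOpposite.unop_sub]

/-- `barA` fixes the scalars. [folklore] -/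
theorem barA_intCast (hO : IsZOrder O) (k : ℤ) : hO.barA p (k : hO.Residue p) = k := by
  simp only [barA, map_intCast, MulOpposite.unop_intCast]

/-- `barA` is an involution. [cite: VignerasLNM800, Ch. I §1] -/
theorem barA_barA (hO : IsZOrder O) (a : hO.Residue p) : hO.barA p (hO.barA p a) = a := by
  obtain ⟨x, rfl⟩ := hO.res_surjective p a
  rw [barA_res, barA_res]
  congr 1
  exact Subtype.ext (hO.standardInvolution_standardInvolution x.2)

/-- `barA` is injective. [folklore] -/
theorem barA_injective (hO : IsZOrder O) : Function.Injective (hO.barA p) := fun a b h => by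
  rw [← hO.barA_barA a, h, barA_barA]

/-- **`a · ā = ā · a = n(a)`**, a scalar, in `A`. [cite: VignerasLNM800, Ch. I §1 Lemme 1.1] -/
theorem res_mul_barA (hO : IsZOrder O) (x : hO.subring) :
    hO.res p x * hO.barA p (hO.res p x) = (nrdZ (x : B) : hO.Residue p) ∧
      hO.barA p (hO.res p x) * hO.res p x = (nrdZ (x : B) : hO.Residue p) := by
  rw [barA_res]
  exact ⟨hO.res_mul_res_barS x, hO.res_barS_mul_res x⟩

/-! ### Non-trivial idempotents: `ē = 1 − e` -/

/-- **A non-trivial idempotent `e = res x` of `O / p O` has `p ∣ n(x)`, `t(x) ≡ 1 (mod p)` and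
`ē = 1 − e`.** (`e ē = n` is a scalar with `n (1 − e) = 0`, so `n ≡ 0` unless `e = 1`; then
`e = e² = t e` forces `t ≡ 1` unless `e = 0`.) [cite: VignerasLNM800, Ch. I §1 Lemme 1.1] -/
theorem idempotent_res (hO : IsZOrder O) (hp : p.Prime) {x : hO.subring}
    (he : IsIdempotentElem (hO.res p x)) (h0 : hO.res p x ≠ 0) (h1 : hO.res p x ≠ 1) :
    (p : ℤ) ∣ nrdZ (x : B) ∧ (trdZ (x : B) : hO.Residue p) = 1 ∧
      hO.barA p (hO.res p x) = 1 - hO.res p x := by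
  set e := hO.res p x with he_def
  set N : hO.Residue p := (nrdZ (x : B) : hO.Residue p) with hN
  set T : hO.Residue p := (trdZ (x : B) : hO.Residue p) with hT
  obtain ⟨hmul, -⟩ := hO.res_mul_barA x
  -- `N = e N`, hence `N (1 − e) = 0`
  have hNe : N = e * N := by
    calc N = e * hO.barA p e := hmul.symm
      _ = e * e * hO.barA p e := by rw [he.eq]
      _ = e * N := by rw [mul_assoc, hmul]
  have hN1e : N * (1 - e) = 0 := by
    rw [mul_sub, mul_one, (Int.cast_commute (nrdZ (x : B)) e).eq, ← hNe, sub_self]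
  -- `p ∣ n(x)`: otherwise `N` is invertible and `e = 1`
  have hdvd : (p : ℤ) ∣ nrdZ (x : B) := by
    by_contra hnd
    obtain ⟨l, hl⟩ := hO.exists_intCast_mul_eq_one hp hnd
    apply h1
    have : (1 : hO.Residue p) - e = 0 := by
      calc (1 : hO.Residue p) - e = (l : hO.Residue p) * N * (1 - e) := by rw [hl, one_mul]
        _ = 0 := by rw [mul_assoc, hN1e, mul_zero]
    exact (sub_eq_zero.mp this).symm
  have hN0 : N = 0 := (hO.intCast_residue_eq_zero_iff hp).mpr hdvd
  -- `e = T e`, hence `T = 1` unless `e = 0`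
  have hsq := hO.res_mul_res (p := p) x
  rw [← he_def, ← hT, ← hN, hN0, sub_zero, he.eq] at hsq
  have hT1 : T = 1 := by
    by_contra hT1
    have hnd : ¬ (p : ℤ) ∣ (trdZ (x : B) - 1) := fun h => hT1 (by
      have := (hO.intCast_residue_eq_zero_iff hp).mpr h
      rw [Int.cast_sub, Int.cast_one, sub_eq_zero] at this
      exact this)
    obtain ⟨l, hl⟩ := hO.exists_intCast_mul_eq_one hp hnd
    apply h0
    calc e = (l : hO.Residue p) * ((trdZ (x : B) - 1 : ℤ) : hO.Residue p) * e := by rw [hl, one_mul]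
      _ = (l : hO.Residue p) * (T * e - e) := by rw [Int.cast_sub, Int.cast_one, mul_assoc, sub_mul, one_mul]
      _ = 0 := by rw [← hsq, sub_self, mul_zero]
  refine ⟨hdvd, hT1, ?_⟩
  rw [barA_res_eq, ← hT, hT1]

/-! ### The involution on the Peirce pieces -/

/-- `barA` maps the Peirce corner `e A e'` into `ē' A ē`. [folklore] -/
theorem barA_mem_peirceCorner (hO : IsZOrder O) {e e' a : hO.Residue p} (ha : a ∈ peirceCorner e e') :
    hO.barA p a ∈ peirceCorner (hO.barA p e') (hO.barA p e) := by
  rw [mem_peirceCorner] at ha ⊢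
  rw [← hO.barA_mul, ← hO.barA_mul, ← mul_assoc, ha]

/-- For a non-trivial idempotent with `ē = f := 1 − e`: `f̄ = e`. [folklore] -/
theorem barA_one_sub (hO : IsZOrder O) {e : hO.Residue p} (hbar : hO.barA p e = 1 - e) :
    hO.barA p (1 - e) = e := by
  rw [barA_sub, barA_one, hbar, sub_sub_cancel]

/-- **`barA : e A e ≃ f A f`** for a non-trivial idempotent (`ē = f`). [folklore] -/
def peirceCornerEquiv (hO : IsZOrder O) {e : hO.Residue p} (hbar : hO.barA p e = 1 - e) :
    peirceCorner e e ≃ peirceCorner (1 - e) (1 - e) where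
  toFun a := ⟨hO.barA p a, by simpa only [hbar] using hO.barA_mem_peirceCorner a.2⟩
  invFun a := ⟨hO.barA p a, by simpa only [hO.barA_one_sub hbar] using hO.barA_mem_peirceCorner a.2⟩
  left_inv a := Subtype.ext (hO.barA_barA (a : hO.Residue p))
  right_inv a := Subtype.ext (hO.barA_barA (a : hO.Residue p))

/-- `|eAe| = |fAf|` for a non-trivial idempotent of `O / p O`. [folklore] -/
theorem card_peirceCorner_eq (hO : IsZOrder O) {e : hO.Residue p} (hbar : hO.barA p e = 1 - e) :
    Nat.card (peirceCorner e e) = Nat.card (peirceCorner (1 - e) (1 - e)) :=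
  Nat.card_congr (hO.peirceCornerEquiv hbar)

/-- The cardinality of an additive subgroup of `O / p O` is a power of `p` (at most `p⁴`). [folklore] -/
theorem card_addSubgroup_residue (hO : IsZOrder O) (hp : p.Prime) (H : AddSubgroup (hO.Residue p)) :
    ∃ i ≤ 4, Nat.card H = p ^ i :=
  (Nat.dvd_prime_pow hp).mp (hO.card_residue hp.ne_zero ▸ H.card_addSubgroup_dvd_card)

omit [Algebra ℚ B] [IsQuaternionAlgebra ℚ B] in
/-- An additive subgroup of `O / p O` containing a non-zero element has cardinality divisible by
`p` (every element is killed by `p`). [folklore] -/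
theorem dvd_card_of_ne_zero_mem (hO : IsZOrder O) (hp : p.Prime) {H : AddSubgroup (hO.Residue p)}
    {a : hO.Residue p} (ha : a ∈ H) (ha0 : a ≠ 0) : p ∣ Nat.card H := by
  haveI : Fact p.Prime := ⟨hp⟩
  have hord : addOrderOf (⟨a, ha⟩ : H) = p := by
    rw [AddSubgroup.addOrderOf_mk]
    refine addOrderOf_eq_prime ?_ ha0
    rw [nsmul_eq_mul, natCast_self_residue, zero_mul]
  have h := addOrderOf_dvd_natCard (⟨a, ha⟩ : H)
  rwa [hord] at h

/-- **Size constraint on the Peirce pieces of a non-trivial idempotent** of `A = O / p O`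
(`|A| = p⁴`, `|eAe| = |fAf|`, `p ∣ |eAe|`): either `|eAe| = |fAf| = p` and `|eAf| |fAe| = p²`, or
`|eAe| = |fAf| = p²` and `|eAf| = |fAe| = 1`. [folklore] -/
theorem card_peirceCorner_cases (hO : IsZOrder O) (hp : p.Prime) {e : hO.Residue p}
    (he : IsIdempotentElem e) (h0 : e ≠ 0) (hbar : hO.barA p e = 1 - e) :
    (Nat.card (peirceCorner e e) = p ∧ Nat.card (peirceCorner (1 - e) (1 - e)) = p ∧
      Nat.card (peirceCorner e (1 - e)) * Nat.card (peirceCorner (1 - e) e) = p ^ 2) ∨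
    (Nat.card (peirceCorner e e) = p ^ 2 ∧ Nat.card (peirceCorner (1 - e) (1 - e)) = p ^ 2 ∧
      Nat.card (peirceCorner e (1 - e)) = 1 ∧ Nat.card (peirceCorner (1 - e) e) = 1) := by
  obtain ⟨i, -, hi⟩ := hO.card_addSubgroup_residue hp (peirceCorner e e)
  obtain ⟨j, -, hj⟩ := hO.card_addSubgroup_residue hp (peirceCorner e (1 - e))
  obtain ⟨k, -, hk⟩ := hO.card_addSubgroup_residue hp (peirceCorner (1 - e) e)
  have hd := hO.card_peirceCorner_eq hbar
  have hprod := card_eq_prod_card_peirceCorner he (R := hO.Residue p)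
  rw [hO.card_residue hp.ne_zero, ← hd, hi, hj, hk, ← pow_add, ← pow_add, ← pow_add] at hprod
  have hexp : 4 = i + j + k + i := Nat.pow_right_injective hp.two_le hprod
  have hpi : p ∣ p ^ i := by
    rw [← hi]
    exact hO.dvd_card_of_ne_zero_mem hp (a := e) (by rw [mem_peirceCorner, he.eq, he.eq]) h0
  have hi1 : 1 ≤ i := by
    rcases Nat.eq_zero_or_pos i with rfl | h
    · rw [pow_zero, Nat.dvd_one] at hpi
      exact absurd hpi hp.one_lt.ne'
    · exact h
  rcases Nat.lt_or_ge i 2 with hlt | hge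
  · have hi' : i = 1 := by omega
    subst hi'
    left
    refine ⟨by rw [hi, pow_one], by rw [← hd, hi, pow_one], ?_⟩
    rw [hj, hk, ← pow_add]
    congr 1
    omega
  · have hi' : i = 2 := by omega
    subst hi'
    right
    have hj0 : j = 0 := by omega
    have hk0 : k = 0 := by omega
    subst hj0; subst hk0
    exact ⟨hi, by rw [← hd, hi], by rw [hj, pow_zero], by rw [hk, pow_zero]⟩

end IsZOrder

end Literature.NumberTheory.Automorphic

end
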